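/-
Copyright: lit-balaban Phase-2 proof seat p08 (gen 7).  Statement-level skeleton of a published paper; no proof claims beyond what
the kernel checks below.
-/
import Literature.MathematicalPhysics.QuantumFieldTheory.BalabanImbrieJaffe1984to88.BIJ88Eq215Torus
import Literature.MathematicalPhysics.QuantumFieldTheory.BalabanImbrieJaffe1984to88.BIJ88Eq551Proof

/-!
# `BalabanImbrieJaffe1984to88.BIJ88Eq551Torus` — T. Bałaban, J. Imbrie, A. Jaffe, *Effective action and cluster properties of the
abelian Higgs model*, Commun. Math. Phys. **114** (1988) 257–315 [BalabanImbrieJaffe1988]: **(5.5.1)** p. 283, `σ_k∂A′ = Q^e_k∂H_kA′`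
*"by (I.6.1.5), (2.15)"* — PROVED OUTRIGHT AT THE TORUS MODEL OF RECORD, together with its [I]-input **(I.6.1.5)** `∂H_k = (I −
∂G_{k,Ax}∂*)Q^{e*}_k∂` on the tori: every hypothesis of the knitting `BIJ88Eq551Proof.eq551_lin`/`eq551_emb` (p02 g3: (I.5.3.1) `h531`,
(I.6.1.4) `h614`, `∂Q^{s*}_k = Q^{e*}_k∂` `hdQ`) is a theorem of the tree's torus calculus (`BIJ85Eq625Torus.HaxE_eq_531`,
`BIJ85Prop522Torus.curlOp_comp_HaxE`, `BIJ85Eq611Torus.curlOp_QsE`), and (2.15) on the tori is `BIJ88Eq215Torus.sigmaTorus_eq_GaxE` /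
`eq215_torus` (p08 g7), so (5.5.1) holds for p30's torus `σ_k = sigmaTorus` and the Landau `H_k = HkE` with NO hypothesis of printed shape

statement-level skeleton of published theorems with citation tags; proofs where landed; nothing here is a claim about the Yang–Mills mass gap

PDF held: `paper:balaban1988-cmp114-bij-abelian-higgs-effective-action` (journal page = PDF page + 256), p. 283 [PDF 27] (text layer
`~/.lit/texts/paper-balaban1988-cmp114-bij-abelian-higgs-effective-action/p0027.txt`, re-read this session); (I) = [BalabanImbrieJaffe1985]
(`paper:balaban1985-cmp97-bij-higgs-minimizers`): (6.1.4)–(6.1.5) p. 319, (5.3.1) p. 317, (5.2.8) p. 316.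

CITATION HEADER (lean-in-tree rule).  Part of the lit-balaban TYPED SKELETON (HOME `run/shared/lean/pub/lit-balaban/`), Phase-2 proof
seat p08 (gen 7), unit `lit-balaban-p08`; WHAT IS REPRODUCED = the **(5.5.1) member of SKELETON row C2.Eq5.5.1-5.5.12** (reader file
`HOME/lit-balaban-r16/ROWS-C2-part2.md`, owner r16, referee ref-5: *"(5.5.1) proved p248303 [p02 g3 BIJ88Eq551Proof]"* — a knitting
identity with the [I] inputs displayed), kind «model instance»; and the Euclidean-operator form of [I] (6.1.5) (row C1.Eq6.1-6.4's
neighbourhood; abstract forms `BIJ85Eq611Proof.eq615` (p30), `BIJ88Eq551Proof.eq615_lin` (p02)).  TAKING line HOME/STATUS.md (gen 7, third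
target).

THE PRINTED TEXT (p. 283 [PDF 27], verbatim): *"5.5. Second Gauge Field Translation. We translate a second time to eliminate most of the
term in 𝒜′_k linear in A′. This is analogous to what is done in Sect. I.6.1. The linear term is almost equal to
⟨Λ₁^{(k)**}L^{−2}Q^{e*}f, Q^e_k∂H_kA′⟩, since by (I.6.1.5), (2.15) we have σ_k∂A′ = Q^e_k∂H_kA′. (5.5.1)"*; (I) p. 319, verbatim: *"By
(5.3.1), H_{k,Ax} = Q^{s*}_k − G_{k,Ax}∂^*Q^{e*}_k∂. Apply ∂ to this identity, and use the gauge invariance statement ∂H_{k,Ax} = ∂H_k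
(6.1.4) and the identity ∂Q^{s*}_k = Q^{e*}_k∂. It follows that ∂H_k = (I − ∂G_{k,Ax}∂^*)Q^{e*}_k∂. (6.1.5)"*.

THE TORUS DATA (all in the tree; standing range `k ≤ m + K` of `Setup`, weight `w = η^d > 0`, lattice factor `c = η⁻¹ ≠ 0`, `2 ≤ d`):
unit-lattice bond fields `A′ : CoarseSpace P k`, η-bond fields `BondSpace P`, η-plaquette fields `PlaqSpace P`, unit-lattice plaquette fields
`UnitPlaqSpace P k`; `σ_k = sigmaTorus hd w c k` ((I.4.2.1)–(I.4.2.2), p30), `∂` on unit bond fields = `dOne P k c`, `∂` on η-bond fields =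
`curlOp w c`, `∂* = LinearMap.adjoint (curlOp w c)`, `Q^{e*}_k = QesOp hd w k`, `Q^e_k = LinearMap.adjoint (QesOp hd w k)`, `Q^{s*}_k = QsE P k`,
`H_{k,Ax} = HaxE P w c k`, `H_k = HkE P w c k` (Landau, (I.4.4.2)), `G_{k,Ax} = GaxE P w c k` ((I.5.2.2) = (I.4.1.1)), `𝒟_k = DkE P w c k`.

WHAT IS PROVED (0 `sorry`, standard axioms; theorems only — proof lane):
* §1 **(I.6.1.5) ON THE TORI** `eq615_torus`: `∂ ∘ H_k = (I − ∂G_{k,Ax}∂*) ∘ Q^{e*}_k ∘ ∂` as linear maps `CoarseSpace P k → PlaqSpace P`,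
  hypothesis-free (p02's `eq615_lin` fed with `HaxE_eq_531`, `curlOp_comp_HaxE`, `curlOp_QsE`); `eq615_torus_DkE` (the `𝒟_k` form, by
  (I.5.2.10) `eq5210_torus`); `eq614_torus` ((I.6.1.4) in the orientation `∂H_{k,Ax} = ∂H_k`).
* §2 **(5.5.1) ON THE TORI** `eq551_torus`: `σ_k ∘ ∂ = Q^e_k ∘ ∂ ∘ H_k`; configuration form `eq551_torus_apply` (`σ_k∂A′ = Q^e_k∂H_kA′` for
  every `A′`), `eq551_torus_Hax` (the same with `H_{k,Ax}`), `eq551_torus_DkE` (with the second expression of (2.15) for `σ_k`), and the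
  pairing in which (5.5.1) is used on p. 283, `inner_sigmaTorus_dOne`: `⟨g, σ_k∂A′⟩ = ⟨Q^{e*}_kg, ∂H_kA′⟩_η`.
* §3 r16's typed ring statement **`BIJ88Sect5StatementsPart3.Eq551` (composed with r18's `sigmaOp`) INHABITED at the torus operators**
  placed in one ring `Module.End ℝ V` by p02's split-embedding dictionary, for ANY slots: `eq551_typed_torus` (σ_k via `G_{k,Ax}`),
  `eq551_typed_torus_DkE` (σ_k via `𝒟_k`, with (2.15) `BIJ88Eq215Torus.eq215_typed_torus`).
HONEST SCOPE.  One torus at a time (`P`, `k ≤ m + K`); the "almost equal" sentence, the translation (5.5.2) and the bounds (5.5.5) are not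
touched (p31's `BIJ88Eq552Cutoff*`, p36's `BIJ88Ineq555Proof`, p02's `BIJ88CrossTerm556`); nothing on d = 4 or the continuum; no `def`,
no new named fact; NOT summit progress.  Unit `lit-balaban-p08` (literature-prover-lit-balaban-p08-g7-0), 2026-08-21.
-/

open scoped BigOperators RealInnerProductSpace

namespace Literature.MathematicalPhysics.QuantumFieldTheory.BalabanImbrieJaffe1984to88.BIJ88Eq551Torus

open Literature.MathematicalPhysics.QuantumFieldTheory.Balaban1983to89
open BIJ85AxialPropagator411 BIJ85Prop521Torus BIJ85Sigma421Torus BIJ85Eq611Torus BIJ85Prop522Torus BIJ85Eq625Torus BIJ88Eq215Torus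

noncomputable section

variable {P : Params}

/-! ## §1  (I.6.1.4)–(I.6.1.5) on the tori, hypothesis-free -/

/-- **(I.6.1.4) ON THE TORI** p. 319, verbatim: *"the gauge invariance statement ∂H_{k,Ax} = ∂H_k (6.1.4)"* — `∂ ∘ H_{k,Ax} = ∂ ∘ H_k` with
`H_{k,Ax} = HaxE`, the Landau `H_k = HkE`, `∂ = curlOp w c` (p11's `curlOp_comp_HaxE` = (I.5.2.8) operator form; p30 gen 6's
`BIJ85Eq611Landau.eq614_landau` is the same with p09's `Hop` packaging); `k ≤ m + K`, `c ≠ 0`, `w > 0`. [cite: BalabanImbrieJaffe1985, (6.1.4) p.319] -/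
theorem eq614_torus {k : ℕ} (hk : k ≤ P.m + P.K) {c : ℝ} (hc : c ≠ 0) {w : ℝ} (hw : 0 < w) :
    curlOp (P := P) w c ∘ₗ HaxE P w c k = curlOp (P := P) w c ∘ₗ HkE P w c k :=
  curlOp_comp_HaxE hk hc hw

/-- **(I.6.1.5) ON THE TORI** p. 319 [PDF 21], verbatim: *"By (5.3.1), H_{k,Ax} = Q^{s*}_k − G_{k,Ax}∂^*Q^{e*}_k∂. Apply ∂ to this identity,
and use the gauge invariance statement ∂H_{k,Ax} = ∂H_k (6.1.4) and the identity ∂Q^{s*}_k = Q^{e*}_k∂. It follows that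
∂H_k = (I − ∂G_{k,Ax}∂^*)Q^{e*}_k∂. (6.1.5)"* — as an identity of linear maps unit bond fields → η-plaquette fields, with the Landau
`H_k = HkE`, `G_{k,Ax} = GaxE`, `Q^{e*}_k = QesOp hd w k`, `∂ = curlOp w c` / `dOne P k c`, and NO hypothesis of printed shape: p02's
linear-map (6.1.5) `BIJ88Eq551Proof.eq615_lin` with (I.5.3.1) = `BIJ85Eq625Torus.HaxE_eq_531`, (6.1.4) = `eq614_torus`,
`∂Q^{s*}_k = Q^{e*}_k∂` = `BIJ85Eq611Torus.curlOp_QsE`; `k ≤ m + K`, `c ≠ 0`, `w > 0`, `2 ≤ d`. [cite: BalabanImbrieJaffe1985, (6.1.5) p.319] -/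
theorem eq615_torus (hd : 2 ≤ P.d) {k : ℕ} (hk : k ≤ P.m + P.K) {c : ℝ} (hc : c ≠ 0) {w : ℝ} (hw : 0 < w) :
    curlOp (P := P) w c ∘ₗ HkE P w c k =
      (LinearMap.id - curlOp (P := P) w c ∘ₗ GaxE P w c k ∘ₗ LinearMap.adjoint (curlOp (P := P) w c)) ∘ₗ
        QesOp (P := P) hd w k ∘ₗ dOne P k c :=
  BIJ88Eq551Proof.eq615_lin (dOne P k c) (curlOp (P := P) w c) (LinearMap.adjoint (curlOp (P := P) w c)) (GaxE P w c k)
    (QesOp (P := P) hd w k) (QsE P k) (HaxE P w c k) (HkE P w c k) (HaxE_eq_531 hd hk hc hw) (eq614_torus hk hc hw)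
    (curlOp_QsE hd hk w c)

/-- (I.6.1.5) on the tori with the propagator `𝒟_k` of (I.4.4.4) in place of `G_{k,Ax}` ((I.5.2.10) `∂G_{k,Ax}∂* = ∂𝒟_k∂*`, p11's
`eq5210_torus`): `∂ ∘ H_k = (I − ∂𝒟_k∂*) ∘ Q^{e*}_k ∘ ∂`. [cite: BalabanImbrieJaffe1985, (6.1.5) p.319] -/
theorem eq615_torus_DkE (hd : 2 ≤ P.d) {k : ℕ} (hk : k ≤ P.m + P.K) {c : ℝ} (hc : c ≠ 0) {w : ℝ} (hw : 0 < w) :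
    curlOp (P := P) w c ∘ₗ HkE P w c k =
      (LinearMap.id - curlOp (P := P) w c ∘ₗ DkE P w c k ∘ₗ LinearMap.adjoint (curlOp (P := P) w c)) ∘ₗ
        QesOp (P := P) hd w k ∘ₗ dOne P k c := by
  rw [← eq5210_torus hk hc hw]
  exact eq615_torus hd hk hc hw

/-- (I.6.1.5) on the tori, configuration form: `∂H_kA′ = Q^{e*}_k∂A′ − ∂G_{k,Ax}∂*Q^{e*}_k∂A′` for every unit bond field `A′`.
[cite: BalabanImbrieJaffe1985, (6.1.5) p.319] -/
theorem eq615_torus_apply (hd : 2 ≤ P.d) {k : ℕ} (hk : k ≤ P.m + P.K) {c : ℝ} (hc : c ≠ 0) {w : ℝ} (hw : 0 < w)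
    (A' : CoarseSpace P k) :
    curlOp (P := P) w c (HkE P w c k A') =
      QesOp (P := P) hd w k (dOne P k c A') -
        curlOp (P := P) w c (GaxE P w c k (LinearMap.adjoint (curlOp (P := P) w c) (QesOp (P := P) hd w k (dOne P k c A')))) := by
  have h := LinearMap.congr_fun (eq615_torus hd hk hc hw) A'
  simpa only [LinearMap.coe_comp, Function.comp_apply, LinearMap.sub_apply, LinearMap.id_apply] using h

/-! ## §2  (5.5.1) on the tori -/

/-- **(5.5.1) ON THE TORI** p. 283 [PDF 27], verbatim: *"since by (I.6.1.5), (2.15) we have σ_k∂A′ = Q^e_k∂H_kA′. (5.5.1)"* — as an identity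
of linear maps unit bond fields on `T^{(k)}` → unit plaquette fields: `σ_k ∘ ∂ = Q^e_k ∘ ∂ ∘ H_k` with `σ_k = sigmaTorus hd w c k` (p30's
torus form of (I.4.2.1)–(I.4.2.2)), the Landau `H_k = HkE`, `Q^e_k = (QesOp hd w k)^*`, `∂ = dOne P k c` (unit lattice) / `curlOp w c`
(η-lattice), and NO hypothesis of printed shape — exactly the printed route: (2.15) (`BIJ88Eq215Torus.sigmaTorus_eq_GaxE`) and (I.6.1.5)
(p02's `BIJ88Eq551Proof.eq551_lin` with the torus inputs of `eq615_torus`); `k ≤ m + K`, `c ≠ 0`, `w > 0`, `2 ≤ d`.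
[cite: BalabanImbrieJaffe1988, (5.5.1) p.283] -/
theorem eq551_torus (hd : 2 ≤ P.d) {k : ℕ} (hk : k ≤ P.m + P.K) {c : ℝ} (hc : c ≠ 0) {w : ℝ} (hw : 0 < w) :
    sigmaTorus (P := P) hd w c k ∘ₗ dOne P k c =
      LinearMap.adjoint (QesOp (P := P) hd w k) ∘ₗ curlOp (P := P) w c ∘ₗ HkE P w c k := by
  rw [sigmaTorus_eq_GaxE hd hk hc hw]
  exact BIJ88Eq551Proof.eq551_lin (dOne P k c) (curlOp (P := P) w c) (LinearMap.adjoint (curlOp (P := P) w c)) (GaxE P w c k)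
    (LinearMap.adjoint (QesOp (P := P) hd w k)) (QesOp (P := P) hd w k) (QsE P k) (HaxE P w c k) (HkE P w c k)
    (HaxE_eq_531 hd hk hc hw) (eq614_torus hk hc hw) (curlOp_QsE hd hk w c)

/-- **(5.5.1) on the tori, configuration form**: `σ_k∂A′ = Q^e_k∂H_kA′` for EVERY unit-lattice bond field `A′` on `T^{(k)}`.
[cite: BalabanImbrieJaffe1988, (5.5.1) p.283] -/
theorem eq551_torus_apply (hd : 2 ≤ P.d) {k : ℕ} (hk : k ≤ P.m + P.K) {c : ℝ} (hc : c ≠ 0) {w : ℝ} (hw : 0 < w)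
    (A' : CoarseSpace P k) :
    sigmaTorus (P := P) hd w c k (dOne P k c A') =
      LinearMap.adjoint (QesOp (P := P) hd w k) (curlOp (P := P) w c (HkE P w c k A')) := by
  have h := LinearMap.congr_fun (eq551_torus hd hk hc hw) A'
  simpa only [LinearMap.coe_comp, Function.comp_apply] using h

/-- (5.5.1) on the tori with the AXIAL minimizer: `σ_k∂A′ = Q^e_k∂H_{k,Ax}A′` ((I.6.1.4) `∂H_{k,Ax} = ∂H_k`).
[cite: BalabanImbrieJaffe1988, (5.5.1) p.283] -/
theorem eq551_torus_Hax (hd : 2 ≤ P.d) {k : ℕ} (hk : k ≤ P.m + P.K) {c : ℝ} (hc : c ≠ 0) {w : ℝ} (hw : 0 < w)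
    (A' : CoarseSpace P k) :
    sigmaTorus (P := P) hd w c k (dOne P k c A') =
      LinearMap.adjoint (QesOp (P := P) hd w k) (curlOp (P := P) w c (HaxE P w c k A')) := by
  have h := LinearMap.congr_fun (eq614_torus (P := P) hk hc hw) A'
  simp only [LinearMap.coe_comp, Function.comp_apply] at h
  rw [h]
  exact eq551_torus_apply hd hk hc hw A'

/-- (5.5.1) on the tori for the SECOND expression of (2.15), `σ_k = Q^e_k(I − ∂𝒟_k∂*)Q^{e*}_k` (`BIJ88Eq215Torus.eq215_torus`):
`Q^e_k(I − ∂𝒟_k∂*)Q^{e*}_k∂ = Q^e_k∂H_k`. [cite: BalabanImbrieJaffe1988, (5.5.1) p.283] -/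
theorem eq551_torus_DkE (hd : 2 ≤ P.d) {k : ℕ} (hk : k ≤ P.m + P.K) {c : ℝ} (hc : c ≠ 0) {w : ℝ} (hw : 0 < w) :
    (LinearMap.adjoint (QesOp (P := P) hd w k) ∘ₗ
        (LinearMap.id - curlOp (P := P) w c ∘ₗ DkE P w c k ∘ₗ LinearMap.adjoint (curlOp (P := P) w c)) ∘ₗ
          QesOp (P := P) hd w k) ∘ₗ dOne P k c =
      LinearMap.adjoint (QesOp (P := P) hd w k) ∘ₗ curlOp (P := P) w c ∘ₗ HkE P w c k := by
  rw [← eq215_torus hd hk hc hw]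
  exact eq551_torus hd hk hc hw

/-- **The pairing in which (5.5.1) is used on p. 283** (*"The linear term is almost equal to ⟨Λ₁^{(k)**}L^{−2}Q^{e*}f, Q^e_k∂H_kA′⟩, since …
σ_k∂A′ = Q^e_k∂H_kA′"*): for every unit plaquette field `g` and unit bond field `A′`, `⟨g, σ_k∂A′⟩ = ⟨g, Q^e_k∂H_kA′⟩ = ⟨Q^{e*}_kg, ∂H_kA′⟩_η`.
[cite: BalabanImbrieJaffe1988, (5.5.1) p.283] -/
theorem inner_sigmaTorus_dOne (hd : 2 ≤ P.d) {k : ℕ} (hk : k ≤ P.m + P.K) {c : ℝ} (hc : c ≠ 0) {w : ℝ} (hw : 0 < w)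
    (g : UnitPlaqSpace P k) (A' : CoarseSpace P k) :
    ⟪g, sigmaTorus (P := P) hd w c k (dOne P k c A')⟫ = ⟪QesOp (P := P) hd w k g, curlOp (P := P) w c (HkE P w c k A')⟫ := by
  rw [eq551_torus_apply hd hk hc hw, LinearMap.adjoint_inner_right]

/-- The symmetric reading: `⟨σ_k∂A′, g⟩ = ⟨∂H_kA′, Q^{e*}_kg⟩_η`. [cite: BalabanImbrieJaffe1988, (5.5.1) p.283] -/
theorem inner_sigmaTorus_dOne_left (hd : 2 ≤ P.d) {k : ℕ} (hk : k ≤ P.m + P.K) {c : ℝ} (hc : c ≠ 0) {w : ℝ} (hw : 0 < w)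
    (A' : CoarseSpace P k) (g : UnitPlaqSpace P k) :
    ⟪sigmaTorus (P := P) hd w c k (dOne P k c A'), g⟫ = ⟪curlOp (P := P) w c (HkE P w c k A'), QesOp (P := P) hd w k g⟫ := by
  rw [eq551_torus_apply hd hk hc hw, LinearMap.adjoint_inner_left]

/-! ## §3  r16's typed `Eq551` (with r18's `sigmaOp`) inhabited at the torus operators (p02's one-ring dictionary) -/

section Typed

variable {V : Type} [AddCommGroup V] [Module ℝ V] {k : ℕ}
  (sB : BIJ88Eq215Proof.Slot (𝕜 := ℝ) (CoarseSpace P k) V) (sA : BIJ88Eq215Proof.Slot (𝕜 := ℝ) (BondSpace P) V)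
  (s₁ : BIJ88Eq215Proof.Slot (𝕜 := ℝ) (UnitPlaqSpace P k) V) (sη : BIJ88Eq215Proof.Slot (𝕜 := ℝ) (PlaqSpace P) V)

/-- **Row C2.Eq5.5.1-5.5.12's typed (5.5.1) `BIJ88Sect5StatementsPart3.Eq551` HOLDS for the torus operators** placed in one ring
`Module.End ℝ V` by ANY split embeddings of the four field spaces (unit bond fields, η-bond fields, unit plaquette fields, η-plaquette
fields): `Eq551 (sigmaOp Q^e_k Q^{e*}_k ∂ ∂* G_{k,Ax}) ∂₁ Q^e_k ∂ H_k` with `Q^e_k = (QesOp)^*`, `Q^{e*}_k = QesOp`, `∂ = curlOp`, `∂* = (curlOp)^*`,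
`G_{k,Ax} = GaxE`, `∂₁ = dOne`, `H_k = HkE` — p02's `eq551_emb` fed with the torus theorems (I.5.3.1) `HaxE_eq_531`, (I.6.1.4) `eq614_torus`,
`∂Q^{s*}_k = Q^{e*}_k∂` `curlOp_QsE`; `k ≤ m + K`, `c ≠ 0`, `w > 0`, `2 ≤ d`. [cite: BalabanImbrieJaffe1988, (5.5.1) p.283] -/
theorem eq551_typed_torus (hd : 2 ≤ P.d) (hk : k ≤ P.m + P.K) {c : ℝ} (hc : c ≠ 0) {w : ℝ} (hw : 0 < w) :
    BIJ88Sect5StatementsPart3.Eq551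
      (BIJ88Sect2Statements.sigmaOp (BIJ88Eq215Proof.emb s₁ sη (LinearMap.adjoint (QesOp (P := P) hd w k)))
        (BIJ88Eq215Proof.emb sη s₁ (QesOp (P := P) hd w k)) (BIJ88Eq215Proof.emb sη sA (curlOp (P := P) w c))
        (BIJ88Eq215Proof.emb sA sη (LinearMap.adjoint (curlOp (P := P) w c))) (BIJ88Eq215Proof.emb sA sA (GaxE P w c k)))
      (BIJ88Eq215Proof.emb s₁ sB (dOne P k c)) (BIJ88Eq215Proof.emb s₁ sη (LinearMap.adjoint (QesOp (P := P) hd w k)))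
      (BIJ88Eq215Proof.emb sη sA (curlOp (P := P) w c)) (BIJ88Eq215Proof.emb sA sB (HkE P w c k)) :=
  BIJ88Eq551Proof.eq551_emb sB sA s₁ sη _ _ _ _ _ _ (QsE P k) (HaxE P w c k) _ (HaxE_eq_531 hd hk hc hw) (eq614_torus hk hc hw)
    (curlOp_QsE hd hk w c)

/-- The same for the SECOND expression of (2.15), `σ_k = sigmaOp Q^e_k Q^{e*}_k ∂ ∂* 𝒟_k` with `𝒟_k = DkE` — p02's `eq551_curlyD` with (2.15)
in the one ring = `BIJ88Eq215Torus.eq215_typed_torus` (p08 g7). [cite: BalabanImbrieJaffe1988, (5.5.1) p.283] -/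
theorem eq551_typed_torus_DkE (hd : 2 ≤ P.d) (hk : k ≤ P.m + P.K) {c : ℝ} (hc : c ≠ 0) {w : ℝ} (hw : 0 < w) :
    BIJ88Sect5StatementsPart3.Eq551
      (BIJ88Sect2Statements.sigmaOp (BIJ88Eq215Proof.emb s₁ sη (LinearMap.adjoint (QesOp (P := P) hd w k)))
        (BIJ88Eq215Proof.emb sη s₁ (QesOp (P := P) hd w k)) (BIJ88Eq215Proof.emb sη sA (curlOp (P := P) w c))
        (BIJ88Eq215Proof.emb sA sη (LinearMap.adjoint (curlOp (P := P) w c))) (BIJ88Eq215Proof.emb sA sA (DkE P w c k)))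
      (BIJ88Eq215Proof.emb s₁ sB (dOne P k c)) (BIJ88Eq215Proof.emb s₁ sη (LinearMap.adjoint (QesOp (P := P) hd w k)))
      (BIJ88Eq215Proof.emb sη sA (curlOp (P := P) w c)) (BIJ88Eq215Proof.emb sA sB (HkE P w c k)) :=
  BIJ88Eq551Proof.eq551_curlyD _ _ _ _ _ _ _ _ (eq215_typed_torus hd hk hc hw s₁ sη sA) (eq551_typed_torus sB sA s₁ sη hd hk hc hw)

end Typed

end

end Literature.MathematicalPhysics.QuantumFieldTheory.BalabanImbrieJaffe1984to88.BIJ88Eq551Torus
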